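import Summits.QuantumFields.YangMills.Theorems.LuscherReductionOneSiteLevelsPhase
import Summits.QuantumFields.YangMills.Theorems.LuscherReductionOneSiteLevelsKacDefs
import Literature.Analysis.OperatorTheory.KernelIMSLocalization
import Literature.Analysis.OperatorTheory.YangMillsMatrixModelEigenfunctions

/-!
# INNER, layer I: the jump-Dirichlet reduction `JumpEnergyLowerInner k ⟹ OneSiteAbsUpperInner k` (exact)

Support module of crux `OneSiteLevels` (route `LuscherReduction`, item stmt-QuantumFields-20007; STUB-PLAN
`Cruxes/OneSiteLevels/STUB-PLAN-stub_absUpperInnerAL1.md` §2.2 items I.1–I.2, owner ruling INNER-RULING-g16), fleet seat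
ym-luscher-20007-p2 (LATTICE lane).  Everything here is proved, AL1-free.

* `qform_eq_linkE_form`: `⟨f, K_B f⟩ = ∫∫ g(U) E_B(U,V) g(V)` with `g = magWeight B f = e^{−(B/2)S} f` (pointwise factorisation
  `K_B = E_B · e^{−(B/2)(S(U)+S(V))}`, `transferKernel_eq_linkE_mul`).
* `qform_eq_linkCE_mul_sub_latticeJump`: `⟨f, K_B f⟩ = linkCE B · (∫ g² − latticeJump B g)` — the jump-Dirichlet identity of
  `KernelIMS.const_mul_integral_sq_sub_eq_half` [LiebYau1988, (2.9)–(2.11)] for the symmetric electric kernel `E_B` with constant row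
  sums `linkCE B` (`integral_linkE_snd`).
* **`qform_le_of_latticeJump_ge`** (I.1): if `a ∫ g² ≤ latticeJump B g + ∫ B·S·g²` then `⟨f, K_B f⟩ ≤ linkCE B · e^{−a} · ‖f‖²`
  (pointwise `(1 − a + B S) e^{−B S} ≤ e^{−a}` from `1 + w ≤ e^w`).
* **`inner_of_jumpEnergyLower`** (I.2): `JumpEnergyLowerInner k` implies the body of the skeleton's `OneSiteAbsUpperInner k`
  verbatim (`a := E_k λ_b − C₁ λ_b²`; `cos Θ_B · ψ` is physical by `IsPhys.mul_of_invariant`).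

## WHAT THIS IS NOT
Not the INNER stub (that needs layers II–III); femto rung R2b1 vocabulary only; NOT an infinite-volume ∕ Clay gap statement.
-/

set_option autoImplicit false

noncomputable section

open MeasureTheory Filter Topology Real
open Literature.MathematicalPhysics.QuantumFieldTheory
open Literature.MathematicalPhysics.QuantumLattice
open Literature.Analysis.OperatorTheory.YMMatrixModel

namespace Summit.QuantumFields.YangMills.Theorems.FemtoTransferGap

/-! ### §1. The electric kernel is symmetric; the magnetic half-weight -/

/-- `E_B(U,V) = E_B(V,U)` (`Re tr(W⁻¹) = Re tr W`). [folklore] -/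
theorem linkE_symm (B : ℝ) (U V : Cfg) : linkE B U V = linkE B V U := by
  unfold linkE
  exact Finset.prod_congr rfl fun e _ => linkW_symm B (V e) (U e)

/-- The magnetic Boltzmann factor is at most `1` for `B ≥ 0` (`S ≥ 0`). [folklore] -/
theorem exp_neg_half_mul_wilsonAction_le_one {B : ℝ} (hB : 0 ≤ B) (U : Cfg) :
    Real.exp (-(B / 2) * wilsonAction su2Rep U) ≤ 1 :=
  Real.exp_le_one_iff.mpr (by nlinarith [wilsonAction_su2_nonneg U])

/-- `magWeight B f` is measurable when `f` is. [folklore] -/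
theorem measurable_magWeight (B : ℝ) {f : Cfg → ℝ} (hf : Measurable f) : Measurable (magWeight B f) := by
  haveI := secondCountableTopology_su2
  have hS : Measurable fun U : Cfg => wilsonAction su2Rep U := (continuous_wilsonAction su2Rep continuous_su2Rep).measurable
  exact (Real.measurable_exp.comp (measurable_const.mul hS)).mul hf

/-- `|magWeight B f U| ≤ |f U|` for `B ≥ 0`. [folklore] -/
theorem abs_magWeight_le {B : ℝ} (hB : 0 ≤ B) (f : Cfg → ℝ) (U : Cfg) : |magWeight B f U| ≤ |f U| := by
  rw [magWeight_apply, abs_mul, abs_of_pos (Real.exp_pos _)]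
  exact mul_le_of_le_one_left (abs_nonneg _) (exp_neg_half_mul_wilsonAction_le_one hB U)

/-- `magWeight B f` is bounded when `f` is (`B ≥ 0`). [folklore] -/
theorem magWeight_bounded {B : ℝ} (hB : 0 ≤ B) {f : Cfg → ℝ} {C : ℝ} (hC : ∀ U, |f U| ≤ C) :
    ∀ U, |magWeight B f U| ≤ C := fun U => (abs_magWeight_le hB f U).trans (hC U)

/-- `(magWeight B f U)² = e^{−B S(U)} f(U)²`. [folklore] -/
theorem magWeight_sq (B : ℝ) (f : Cfg → ℝ) (U : Cfg) :
    magWeight B f U ^ 2 = Real.exp (-(B * wilsonAction su2Rep U)) * f U ^ 2 := by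
  rw [magWeight_apply, mul_pow, ← Real.exp_nat_mul]
  congr 2; ring

/-- A bounded measurable real function is integrable for the one-site a-priori (probability) measure. [folklore] -/
theorem integrable_cfgMeasure_of_bounded {g : Cfg → ℝ} (hg : Measurable g) {C : ℝ} (hb : ∀ U, |g U| ≤ C) :
    Integrable g cfgMeasure :=
  Integrable.of_bound hg.aestronglyMeasurable C (ae_of_all _ fun U => by rw [Real.norm_eq_abs]; exact hb U)

/-! ### §2. The transfer form in electric currency and the jump-Dirichlet identity -/

/-- `⟨f, K_B f⟩ = ∫∫ g(U) E_B(U,V) g(V)` with `g = magWeight B f` (pointwise factorisation of the kernel; no integrability needed).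
[cite: Luscher1983, §3] -/
theorem qform_eq_linkE_form (B : ℝ) (f : Cfg → ℝ) :
    qform su2Rep B f f = ∫ U, ∫ V, magWeight B f U * linkE B U V * magWeight B f V ∂cfgMeasure ∂cfgMeasure := by
  unfold qform
  refine integral_congr_ae (ae_of_all _ fun U => integral_congr_ae (ae_of_all _ fun V => ?_))
  show f U * transferKernel su2Rep B U V * f V = magWeight B f U * linkE B U V * magWeight B f V
  rw [transferKernel_eq_linkE_mul, magWeight_apply, magWeight_apply,
    show -(B / 2) * (wilsonAction su2Rep U + wilsonAction su2Rep V) =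
      -(B / 2) * wilsonAction su2Rep U + -(B / 2) * wilsonAction su2Rep V by ring, Real.exp_add]
  ring

/-- **Jump-Dirichlet identity for the transfer form**: for measurable bounded `f` and `B ≥ 0`,
`⟨f, K_B f⟩ = linkCE B · (∫ g² − latticeJump B g)`, `g = magWeight B f`. [cite: LiebYau1988, (2.9)–(2.11)] -/
theorem qform_eq_linkCE_mul_sub_latticeJump {B : ℝ} (hB : 0 ≤ B) {f : Cfg → ℝ} (hfm : Measurable f) {C : ℝ}
    (hfb : ∀ U, |f U| ≤ C) :
    qform su2Rep B f f = linkCE B * ((∫ U, magWeight B f U ^ 2 ∂cfgMeasure) - latticeJump B (magWeight B f)) := by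
  set g := magWeight B f with hg
  have hgm : Measurable g := measurable_magWeight B hfm
  have hgb : ∀ U, |g U| ≤ C := magWeight_bounded hB hfb
  have hC0 : 0 ≤ C := (abs_nonneg _).trans (hfb (fun _ => 1))
  have hI : Integrable (fun p : Cfg × Cfg => g p.1 * linkE B p.1 p.2 * g p.2) (cfgMeasure.prod cfgMeasure) :=
    integrable_sandwich' (measurable_linkE B) (fun p => abs_linkE_le hB p.1 p.2) hgm hgm hgb hgb
  have hI₁ : Integrable (fun p : Cfg × Cfg => linkE B p.1 p.2 * g p.1 ^ 2) (cfgMeasure.prod cfgMeasure) := by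
    refine integrable_cfgProd ((measurable_linkE B).mul ((hgm.pow_const 2).comp measurable_fst))
      (C := Real.exp (2 * B) ^ Fintype.card (Edge 3 1) * C ^ 2) fun p => ?_
    rw [abs_mul, abs_pow]
    exact mul_le_mul (abs_linkE_le hB _ _) (pow_le_pow_left₀ (abs_nonneg _) (hgb _) 2) (by positivity) (by positivity)
  have key := Literature.Analysis.OperatorTheory.KernelIMS.const_mul_integral_sq_sub_eq_half (μ := cfgMeasure)
    (linkE B) g (c := linkCE B) (linkE_symm B) (ae_of_all _ fun U => integral_linkE_snd B U) hI hI₁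
  have hpos : 0 < linkCE B := linkCE_pos hB
  rw [qform_eq_linkE_form, ← hg]
  unfold latticeJump
  rw [← key]
  field_simp
  ring

/-! ### §3. Layer I -/

/-- The pointwise inequality behind layer I: `(1 − a + B S) e^{−B S} f² ≤ e^{−a} f²` (`1 + w ≤ e^w`, `w = B S − a`). [folklore] -/
theorem one_sub_add_mul_exp_neg_le (a B S c : ℝ) :
    (1 - a + B * S) * (Real.exp (-(B * S)) * c ^ 2) ≤ Real.exp (-a) * c ^ 2 := by
  have h1 : 1 - a + B * S ≤ Real.exp (B * S - a) := by
    have := Real.add_one_le_exp (B * S - a); linarith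
  have h2 : Real.exp (B * S - a) * Real.exp (-(B * S)) = Real.exp (-a) := by
    rw [← Real.exp_add]; congr 1; ring
  have h3 : 0 ≤ Real.exp (-(B * S)) * c ^ 2 := by positivity
  calc (1 - a + B * S) * (Real.exp (-(B * S)) * c ^ 2) ≤ Real.exp (B * S - a) * (Real.exp (-(B * S)) * c ^ 2) :=
        mul_le_mul_of_nonneg_right h1 h3
    _ = Real.exp (-a) * c ^ 2 := by rw [← mul_assoc, h2]

/-- **Layer I.1 — jump-Dirichlet reduction.**  For `B > 0` and a physical `f` with `g = magWeight B f`: if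
`a ∫ g² ≤ latticeJump B g + ∫ B·S·g²`, then `⟨f, K_B f⟩ ≤ linkCE B · e^{−a} · ‖f‖²`.  (The potential enters UNSATURATED; exact
algebra: `⟨f,K_Bf⟩ = linkCE(∫g² − latticeJump g) ≤ linkCE ∫ (1 − a + BS) e^{−BS} f² ≤ linkCE e^{−a} ∫ f²`.)
[cite: LiebYau1988, (2.9)–(2.11)] [cite: Luscher1983, §3] -/
theorem qform_le_of_latticeJump_ge {B a : ℝ} (hB : 0 < B) {f : Cfg → ℝ} (hf : IsPhys f)
    (h : a * ∫ U, magWeight B f U ^ 2 ∂cfgMeasure ≤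
      latticeJump B (magWeight B f) + ∫ U, B * wilsonAction su2Rep U * magWeight B f U ^ 2 ∂cfgMeasure) :
    qform su2Rep B f f ≤ linkCE B * Real.exp (-a) * l2 f f := by
  obtain ⟨C, hC⟩ := hf.bounded
  have hfm := hf.measurable
  haveI := secondCountableTopology_su2
  have hSm : Measurable fun U : Cfg => wilsonAction su2Rep U := (continuous_wilsonAction su2Rep continuous_su2Rep).measurable
  have hpos : 0 < linkCE B := linkCE_pos hB.le
  -- integrability of the three bounded integrands on the probability space
  have hf2b : ∀ U : Cfg, |f U ^ 2| ≤ C ^ 2 := fun U => by rw [abs_pow]; exact pow_le_pow_left₀ (abs_nonneg _) (hC U) 2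
  have hg2i : Integrable (fun U => magWeight B f U ^ 2) cfgMeasure :=
    integrable_cfgMeasure_of_bounded ((measurable_magWeight B hfm).pow_const 2) (C := C ^ 2)
      fun U => by rw [abs_pow]; exact pow_le_pow_left₀ (abs_nonneg _) (magWeight_bounded hB.le hC U) 2
  -- `B S e^{-BS} ≤ 1`
  have hBSexp : ∀ U : Cfg, B * wilsonAction su2Rep U * Real.exp (-(B * wilsonAction su2Rep U)) ≤ 1 := fun U => by
    have h1 : B * wilsonAction su2Rep U ≤ Real.exp (B * wilsonAction su2Rep U) := by
      linarith [Real.add_one_le_exp (B * wilsonAction su2Rep U)]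
    have h2 : Real.exp (B * wilsonAction su2Rep U) * Real.exp (-(B * wilsonAction su2Rep U)) = 1 := by
      rw [← Real.exp_add, add_neg_cancel, Real.exp_zero]
    calc B * wilsonAction su2Rep U * Real.exp (-(B * wilsonAction su2Rep U))
        ≤ Real.exp (B * wilsonAction su2Rep U) * Real.exp (-(B * wilsonAction su2Rep U)) :=
          mul_le_mul_of_nonneg_right h1 (Real.exp_pos _).le
      _ = 1 := h2
  have hBSi : Integrable (fun U => B * wilsonAction su2Rep U * magWeight B f U ^ 2) cfgMeasure := by
    refine integrable_cfgMeasure_of_bounded ((measurable_const.mul hSm).mul ((measurable_magWeight B hfm).pow_const 2))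
      (C := C ^ 2) fun U => ?_
    rw [magWeight_sq, ← mul_assoc, abs_mul, abs_of_nonneg (by
      have := wilsonAction_su2_nonneg U; have := Real.exp_pos (-(B * wilsonAction su2Rep U)); positivity)]
    calc B * wilsonAction su2Rep U * Real.exp (-(B * wilsonAction su2Rep U)) * |f U ^ 2| ≤ 1 * C ^ 2 :=
          mul_le_mul (hBSexp U) (hf2b U) (abs_nonneg _) zero_le_one
      _ = C ^ 2 := one_mul _
  have hf2i : Integrable (fun U => Real.exp (-a) * f U ^ 2) cfgMeasure :=
    (integrable_cfgMeasure_of_bounded (hfm.pow_const 2) hf2b).const_mul _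
  -- the pointwise bound, integrated
  have hint : ∫ U, (1 - a) * magWeight B f U ^ 2 + B * wilsonAction su2Rep U * magWeight B f U ^ 2 ∂cfgMeasure ≤
      ∫ U, Real.exp (-a) * f U ^ 2 ∂cfgMeasure := by
    refine integral_mono ((hg2i.const_mul _).add hBSi) hf2i fun U => ?_
    show (1 - a) * magWeight B f U ^ 2 + B * wilsonAction su2Rep U * magWeight B f U ^ 2 ≤ Real.exp (-a) * f U ^ 2
    rw [magWeight_sq]
    have := one_sub_add_mul_exp_neg_le a B (wilsonAction su2Rep U) (f U)
    linarith
  rw [integral_add (hg2i.const_mul _) hBSi, integral_const_mul, integral_const_mul] at hint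
  have hl2 : l2 f f = ∫ U, f U ^ 2 ∂cfgMeasure := by unfold l2; congr 1; funext U; ring
  rw [qform_eq_linkCE_mul_sub_latticeJump hB.le hfm hC, hl2, mul_assoc]
  refine mul_le_mul_of_nonneg_left ?_ hpos.le
  linarith

/-- `cos Θ_B · ψ` is physical for a physical `ψ` (`Θ_B = onePhase ℓ` is measurable, gauge- and twist-invariant). [folklore] -/
theorem isPhys_cos_onePhase_mul (ℓ : ℝ) {ψ : Cfg → ℝ} (hψ : IsPhys ψ) :
    IsPhys (fun U => Real.cos (onePhase ℓ U) * ψ U) :=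
  hψ.mul_of_invariant (Real.measurable_cos.comp (measurable_onePhase ℓ)) (CJ := 1) (fun U => Real.abs_cos_le_one _)
    (fun g U => by rw [onePhase_gaugeTransform]) (fun k z hz U => by rw [onePhase_twist ℓ k hz])

/-- **Layer I.2 — `JumpEnergyLowerInner k ⟹ OneSiteAbsUpperInner k`** (the skeleton's INNER statement verbatim, with the same
constants): apply I.1 with `a := E_k λ_b − C₁ λ_b²` to `f = cos Θ_B · ψ`. [cite: Luscher1983, §3] [cite: SimonB1983DiscreteSpectrum, §3] -/
theorem inner_of_jumpEnergyLower (k : ℕ) (h : JumpEnergyLowerInner k) :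
    ∃ C₁ B₁ : ℝ, 2 ≤ B₁ ∧ ∀ B, B₁ ≤ B → ∃ φs : Fin k → Cfg → ℝ, (∀ i, IsPhys (φs i)) ∧
      ∀ ψ : Cfg → ℝ, IsPhys ψ → (∀ i, l2 ψ (φs i) = 0) →
      qform su2Rep B (fun U => Real.cos (onePhase (onePhaseScale B) U) * ψ U) (fun U => Real.cos (onePhase (onePhaseScale B) U) * ψ U)
        ≤ linkCE B * Real.exp (-(physLevel (k + 1) * bareLambda B) + C₁ * bareLambda B ^ 2)
          * l2 (fun U => Real.cos (onePhase (onePhaseScale B) U) * ψ U) (fun U => Real.cos (onePhase (onePhaseScale B) U) * ψ U) := by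
  obtain ⟨C₁, B₁, hB₁, hjump⟩ := h
  refine ⟨C₁, B₁, hB₁, fun B hB => ?_⟩
  obtain ⟨φs, hφs, hψ⟩ := hjump B hB
  refine ⟨φs, hφs, fun ψ hψphys horth => ?_⟩
  have hBpos : 0 < B := by linarith
  have key := qform_le_of_latticeJump_ge (a := physLevel (k + 1) * bareLambda B - C₁ * bareLambda B ^ 2) hBpos
    (isPhys_cos_onePhase_mul (onePhaseScale B) hψphys) (hψ ψ hψphys horth)
  have e : -(physLevel (k + 1) * bareLambda B - C₁ * bareLambda B ^ 2) =
      -(physLevel (k + 1) * bareLambda B) + C₁ * bareLambda B ^ 2 := by ring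
  rw [e] at key
  exact key

end Summit.QuantumFields.YangMills.Theorems.FemtoTransferGap

end
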